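import Literature.NumberTheory.GaloisRepresentations.ArtinRestriction
import Literature.NumberTheory.GaloisRepresentations.AbsGaloisInvolutions
import Literature.NumberTheory.NumberFields.UnramifiedCompositum
import Literature.NumberTheory.GaloisCohomology.RestrictedRamificationCdTwoBaseChange
import Mathlib.GroupTheory.IndexNormal
import Mathlib.NumberTheory.NumberField.InfinitePlace.TotallyRealComplex
import HarnessLib

/-!
# The dihedral field of the small-image datum as a NUMBER FIELD (brick AH1a of the odd-`p` Hecke theta partner)

Route `SignedLowerHalves`, child L `SmallImageLowerHalfBothSigns` (item stmt-BirchSwinnertonDyer-23599), line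
`rtt_w3`, stub K0₂@p `stub_heckeThetaPartner_ns` — construction brick AH1a of the arithmetic half at an ODD prime
(width seat `bsd-line-slh-p3-w3` gen 10; memo `Lines/birth_acns-MEMO-w3-g9.md` §2 «AH1»).  THEOREMS ONLY (no
definition, no named fact, no `sorry`); ROUTE-INDEPENDENT.

Setting: `U ≤ Γ_ℚ` an OPEN subgroup of INDEX `2` containing NO complex conjugation (the subgroup
`U = ρ̄⁻¹(Φ⁻¹(kˣ))` of the small-image datum, `…KobayashiMainConjectureSmallImageShadowInert`).

* `exists_numberField_of_index_two` — there is a number field `K` (a TYPE, with its `Field`/`NumberField`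
  structure; every `ℚ`-algebra structure on it is the canonical one), Galois over `ℚ`, TOTALLY COMPLEX, of degree
  `2`, whose absolute Galois group maps ONTO `U` under `res_{K/ℚ}` (`(absGaloisRestrict ℚ K).range = U`), and which
  is UNRAMIFIED at every finite place `v` of `ℚ` all of whose inertia groups lie in `U`
  (`Algebra.IsUnramifiedIn (𝓞 K) v`).  Construction: `K = ℚ̄^U` (Krull correspondence for the open subgroup `U`,
  `fixingSubgroup_fixedField_of_isOpen`; `res(Γ_K) = g U g⁻¹ = U` by normality of an index-`2` subgroup;
  Galois by `InfiniteGalois.normal_iff_isGalois`; no real place: a real place of `K` would give an involution of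
  `Γ_K` whose restriction is an involution `≠ 1` of `Γ_ℚ` inside `U`, hence (Artin–Schreier,
  `exists_isComplexConjugation_of_sq_eq_one`) a complex conjugation in `U`; unramifiedness by the tree's criterion
  `isUnramifiedIn_iff_forall_inertia_absRestrictNormalHom_eq_one`).

These are the hypotheses `K, hK2, [IsGalois ℚ K], [IsTotallyComplex K], hU, hKU` (and the source of `hpd`, `hdK`)
of `heckeThetaPartner_of_inertField` (brick R6).  BSD, crux L and the stub are NOT proved here.

References: J. Neukirch, ANT IV §1 (Krull), I §9; E. Artin–O. Schreier 1927 (Satz 4); J.-P. Serre 1972 §5.2 (iv).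
-/

set_option autoImplicit false
set_option linter.dupNamespace false

noncomputable section

open scoped NumberField Pointwise
open Field NumberField IsDedekindDomain IntermediateField
  Literature.NumberTheory.GaloisRepresentations Literature.NumberTheory.NumberFields

namespace Summit.BirchSwinnertonDyer.BirchSwinnertonDyer.Theorems.SmallImageLambdaLowerThreeNsThetaPartner

section Generic

variable {F : Type} [Field F] [NumberField F]

/-- **The fixed field of an open index-`2` subgroup without complex conjugations, over any number field `F`.**
For an open subgroup `U ≤ Γ_F` of index `2` containing no complex conjugation (for any real embedding of `F`)
there is a finite extension `K/F` (a number field), Galois of degree `2`, TOTALLY COMPLEX, with `res(Γ_K) = U`,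
unramified at every finite place of `F` whose inertia groups lie in `U`.  (`K = F̄^U`.)
[cite: NeukirchANT1999, Ch. IV §1 Thm. (1.2), Ch. I §9 (9.6)] [cite: ArtinSchreier1927Kennzeichnung, Satz 4] -/
theorem exists_numberField_of_index_two_over (U : Subgroup (absoluteGaloisGroup F))
    (hopen : IsOpen (U : Set (absoluteGaloisGroup F))) (hidx : U.index = 2)
    (himag : ∀ (φ : F →+* ℝ) (c : absoluteGaloisGroup F), IsComplexConjugation φ c → c ∉ U) :
    ∃ (K : Type) (_ : Field K) (_ : Algebra F K) (_ : NumberField K), IsGalois F K ∧ IsTotallyComplex K ∧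
      Module.finrank F K = 2 ∧ (absGaloisRestrict F K).range = U ∧
      ∀ v : HeightOneSpectrum (𝓞 F),
        (∀ 𝔓 ∈ v.primesAbove, 𝔓.inertia (absoluteGaloisGroup F) ≤ U) → Algebra.IsUnramifiedIn (𝓞 K) v.asIdeal := by
  classical
  haveI hnormal : U.Normal := Subgroup.normal_of_index_eq_two hidx
  -- the fixed field `L = F̄^U`
  set L : IntermediateField F (AlgebraicClosure F) := IntermediateField.fixedField U with hL
  have hfix : L.fixingSubgroup = U := fixingSubgroup_fixedField_of_isOpen U hopen
  haveI hfd : FiniteDimensional F L := finiteDimensional_fixedField_of_isOpen U hopen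
  have hdeg : Module.finrank F L = 2 := (finrank_fixedField_of_isOpen U hopen).trans hidx
  haveI hGal : IsGalois F L := (InfiniteGalois.normal_iff_isGalois L).mp (hfix ▸ hnormal)
  haveI : NumberField L := NumberField.of_module_finite F L
  -- `res(Γ_L) = U`
  have hrange : (absGaloisRestrict F L).range = U := by
    obtain ⟨g, hg⟩ := exists_mem_range_absGaloisRestrict_fixedField_iff U hopen
    ext γ
    refine (hg γ).trans ⟨fun h => ?_, fun h => ?_⟩
    · have := hnormal.conj_mem _ h g
      rwa [← mul_assoc, ← mul_assoc, mul_inv_cancel, one_mul, mul_inv_cancel_right] at this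
    · have := hnormal.conj_mem _ h g⁻¹
      rwa [inv_inv] at this
  -- unramified where the inertia lies in `U`
  have hunr : ∀ v : HeightOneSpectrum (𝓞 F),
      (∀ 𝔓 ∈ v.primesAbove, 𝔓.inertia (absoluteGaloisGroup F) ≤ U) → Algebra.IsUnramifiedIn (𝓞 L) v.asIdeal := by
    intro v hv
    refine (isUnramifiedIn_iff_forall_inertia_absRestrictNormalHom_eq_one L v).2 fun 𝔓 h𝔓 g hg => ?_
    have hgU : g ∈ L.fixingSubgroup := hfix ▸ hv 𝔓 h𝔓 hg
    exact (absRestrictNormalHom_eq_one_iff_forall_smul L g).2 ((mem_fixingSubgroup_iff_forall_smul L g).1 hgU)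
  -- no real place
  haveI : IsTotallyComplex L := by
    refine ⟨fun w => ?_⟩
    by_contra hw
    rw [InfinitePlace.not_isComplex_iff_isReal] at hw
    obtain ⟨cK, hcK⟩ := exists_isComplexConjugation (InfinitePlace.embedding_of_isReal hw)
    set c : absoluteGaloisGroup F := absGaloisRestrict F L cK with hc
    have hcU : c ∈ U := hrange ▸ ⟨cK, rfl⟩
    have hc1 : c ≠ 1 := fun h => hcK.ne_one (absGaloisRestrict_injective F L (by rw [← hc, h, map_one]))
    have hc2 : c ^ 2 = 1 := by rw [hc, ← map_pow, hcK.sq_eq_one, map_one]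
    obtain ⟨φ, hφ⟩ := exists_isComplexConjugation_of_sq_eq_one c hc1 hc2
    exact himag φ c hφ hcU
  exact ⟨L, inferInstance, inferInstance, inferInstance, hGal, inferInstance, hdeg, hrange, hunr⟩

end Generic

section Transport

variable {K : Type} [Field K]

/-- Transport of the package «Galois, degree `2`, `res(Γ_K) = U`, unramified where the inertia lies in `U`» along
the (unique) equality of two `ℚ`-algebra structures on `K` (`Rat.algebra_rat_subsingleton`). [folklore] -/
theorem galoisPackage_of_algebra_eq (i₁ i₂ : Algebra ℚ K) (U : Subgroup (absoluteGaloisGroup ℚ))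
    (h : (letI := i₁; IsGalois ℚ K ∧ Module.finrank ℚ K = 2 ∧ (absGaloisRestrict ℚ K).range = U ∧
      ∀ v : HeightOneSpectrum (𝓞 ℚ),
        (∀ 𝔓 ∈ v.primesAbove, 𝔓.inertia (absoluteGaloisGroup ℚ) ≤ U) → Algebra.IsUnramifiedIn (𝓞 K) v.asIdeal)) :
    (letI := i₂; IsGalois ℚ K ∧ Module.finrank ℚ K = 2 ∧ (absGaloisRestrict ℚ K).range = U ∧
      ∀ v : HeightOneSpectrum (𝓞 ℚ),
        (∀ 𝔓 ∈ v.primesAbove, 𝔓.inertia (absoluteGaloisGroup ℚ) ≤ U) → Algebra.IsUnramifiedIn (𝓞 K) v.asIdeal) := by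
  have h12 : i₁ = i₂ := Subsingleton.elim _ _
  subst h12
  exact h

end Transport

section Main

/-- **The dihedral field as a number field.**  For an open subgroup `U ≤ Γ_ℚ` of index `2` containing no complex
conjugation there is a number field `K`, Galois and totally complex, `[K : ℚ] = 2`, with `res(Γ_K) = U`, unramified at
every finite place of `ℚ` whose inertia groups lie in `U` — all for the CANONICAL `ℚ`-algebra structure of the
number field `K`.  See the module docstring.
[cite: NeukirchANT1999, Ch. IV §1 Thm. (1.2), Ch. I §9 (9.6)] [cite: ArtinSchreier1927Kennzeichnung, Satz 4] -/
theorem exists_numberField_of_index_two (U : Subgroup (absoluteGaloisGroup ℚ))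
    (hopen : IsOpen (U : Set (absoluteGaloisGroup ℚ))) (hidx : U.index = 2)
    (himag : ∀ c : absoluteGaloisGroup ℚ, IsComplexConjugation (Rat.castHom ℝ) c → c ∉ U) :
    ∃ (K : Type) (_ : Field K) (_ : NumberField K), IsGalois ℚ K ∧ IsTotallyComplex K ∧
      Module.finrank ℚ K = 2 ∧ (absGaloisRestrict ℚ K).range = U ∧
      ∀ v : HeightOneSpectrum (𝓞 ℚ),
        (∀ 𝔓 ∈ v.primesAbove, 𝔓.inertia (absoluteGaloisGroup ℚ) ≤ U) → Algebra.IsUnramifiedIn (𝓞 K) v.asIdeal := by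
  have himag' : ∀ (φ : ℚ →+* ℝ) (c : absoluteGaloisGroup ℚ), IsComplexConjugation φ c → c ∉ U := fun φ c hc =>
    himag c (Subsingleton.elim φ (Rat.castHom ℝ) ▸ hc)
  obtain ⟨K, _, i, _, hGal, htc, hdeg, hrange, hunr⟩ := exists_numberField_of_index_two_over U hopen hidx himag'
  obtain ⟨h1, h2, h3, h4⟩ := galoisPackage_of_algebra_eq (K := K) i DivisionRing.toRatAlgebra U
    ⟨hGal, hdeg, hrange, hunr⟩
  exact ⟨K, inferInstance, inferInstance, h1, htc, h2, h3, h4⟩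

end Main

end Summit.BirchSwinnertonDyer.BirchSwinnertonDyer.Theorems.SmallImageLambdaLowerThreeNsThetaPartner

end
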